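import Summits.AtomisticToContinuum.FouriersLaw.Theses.OddSectorIrreversibility

/-!
# RepairSketchK2 — crux-ideate k=2 for `ClosedConeSensitivity` (stmt-AtomisticToContinuum-14059)

Statements only (defs of `Prop`s); nothing is asserted. They accompany
`Negative-notes/annealed-blob-amplifier.md` (this seat):

* `AnnealedAmplifierHypothesis` — the obstruction, as a hypothesis `H` for a disprover's
  `H → ¬ ClosedConeSensitivity` lane: super-exponential growth of the Gibbs-mean-square (annealed)
  tangent response AT the contact (thermal-blob amplifier; kit j011359).
* `TapDecoupling` — the fixed-`N` Gaussian identity/inequality that lets the route's glue pair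
  `∂_{p_b} u⁺` with a RESAMPLED (finite, thermal-size) kick sensitivity instead of a derivative.
* `ResampledConeSensitivity`, `FiniteKickConeSensitivity` — the repaired cruxes (no `s²`,
  stretched-exponential tail `exp(-κ √(d - t/a))`) recommended to the route planner.
-/

namespace Summit.AtomisticToContinuum.FouriersLaw.Cruxes.ClosedConeSensitivity.IdeatorK2

open MeasureTheory
open Literature.MathematicalPhysics.KineticTheory.HeatConduction

/-- OBSTRUCTION HYPOTHESIS (thermal-blob / Griffiths amplifier): the annealed (Gibbs mean-square)
sensitivity of the contact momentum to a contact kick grows FASTER THAN ANY EXPONENTIAL in time,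
uniformly available at large `N`: for every rate `Λ` there is a time `t` (and all large `N`) at which
`liminf_{s→0} s⁻² ∫ (p_b(Φ_t(kick_s x)) − p_b(Φ_t x))² dμ_T ≥ e^{Λ t} · Z`, written with an explicit
small-`s` quantifier. Mechanism: a rare hot blob of energy `E` at the contact (Gibbs cost `e^{-E/T}`,
`d`-independent) scrambles at rate `λ(E/k) ~ E^{1/4}` (quartic scaling, kit j011359 PART A: slope 0.30)
and cools only diffusively, so its excess log-gain grows without saturating (PART B: linear in `t` up to
`t = 300`, exceeding `E/T = 53` by `t = 300`); `sup_E` gives a super-linear exponent. -/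
def AnnealedAmplifierHypothesis : Prop :=
  ∀ ω₂ lam β : ℝ, 0 < ω₂ → 0 < lam → 0 < β → ∀ T : ℝ, 0 < T →
    ∀ Λ : ℝ, ∃ t : ℝ, 0 < t ∧ ∃ N₀ : ℕ, ∀ N : ℕ, N₀ ≤ N → ∀ b : Fin N, b.val = 0 →
      ∃ s₀ : ℝ, 0 < s₀ ∧ ∀ s : ℝ, 0 < s → s ≤ s₀ →
      let P₀ := pinnedChain ω₂ lam β 0
      let μT : Measure (PhaseSpace N) :=
        volume.withDensity (fun x : PhaseSpace N => ENNReal.ofReal (Real.exp (-(P₀.hamiltonian N x) / T)))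
      Real.exp (Λ * t) * s ^ 2 * ∫ x, Real.exp (-(P₀.hamiltonian N x) / T) ∂volume ≤
        ∫ x, ((∫ y, y.2 b ∂(P₀.transitionKernel N T T t.toNNReal (x.1, Function.update x.2 b (x.2 b + s))))
              - (∫ y, y.2 b ∂(P₀.transitionKernel N T T t.toNNReal x))) ^ 2 ∂μT

/-- TAP DECOUPLING (fixed `N`, Gaussian integration by parts in the contact momentum `p_b`, which is
an independent `N(0,T)` coordinate under `μ_T`): for smooth `f, g`,
`|∫ ∂_{p_b}f · ∂_{p_b}g dμ_T| ≤ T⁻¹ ‖T ∂²_{p_b} f − p_b ∂_{p_b} f‖_{L²(μ_T)} · (½ ∫∫ (g(x^{b←p'}) − g(x))² dμ_T dN(0,T)(p'))^{1/2}`,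
because `S_b f := T∂²_b f − p_b ∂_b f` has zero conditional mean given the other coordinates, so it only
sees `g − E[g | x_{≠ p_b}]`, whose squared norm is half the RESAMPLING sensitivity. This is what lets the
route's leak term `⟨∂_b u⁺, ∂_b (j_i∘Φ_t)⟩` be bounded by a FINITE thermal kick of `j_i∘Φ_t` (immune to
the amplifier) at the price of `‖S_b u⁺‖ ≤ ‖A u⁻‖/γ` instead of `‖∂_b u‖`. -/
def TapDecoupling : Prop :=
  ∀ (N : ℕ) (b : Fin N) (T : ℝ), 0 < T → ∀ (Φ : (Fin N → ℝ) → ℝ),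
    ∀ f g : PhaseSpace N → ℝ, ContDiff ℝ 2 f → ContDiff ℝ 1 g →
    let μT : Measure (PhaseSpace N) :=
      volume.withDensity (fun x : PhaseSpace N =>
        ENNReal.ofReal (Real.exp (-((∑ i, x.2 i ^ 2 / 2) + Φ x.1) / T)))
    let Sf : PhaseSpace N → ℝ := fun x => T * partialP b (partialP b f) x - x.2 b * partialP b f x
    MemLp (partialP b f) 2 μT → MemLp (partialP b g) 2 μT → MemLp Sf 2 μT → MemLp g 2 μT →
    |∫ x, partialP b f x * partialP b g x ∂μT| ≤
      T⁻¹ * Real.sqrt (∫ x, (Sf x) ^ 2 ∂μT) *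
        Real.sqrt ((1 / 2) * ∫ x, (∫ p', (g (x.1, Function.update x.2 b p') - g x) ^ 2 *
            (Real.exp (-(p' ^ 2) / (2 * T)) / Real.sqrt (2 * Real.pi * T)) ∂volume) ∂μT)

/-- REPAIRED CRUX, resampling form (recommended): thermal RESAMPLING of the contact momentum instead of
an infinitesimal kick (no `s²`), and a STRETCHED-exponential tail `exp(-κ √(d − t/a))` instead of
`exp(-κ (d − t/a))` (receiving-end / mid-path blobs cost only `e^{-c√m}` to relaunch the damage `m` bonds
ahead of the nominal front). Any tail `φ` with `Σ_m m φ(m/2)^{1/2} < ∞` serves the glue. -/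
def ResampledConeSensitivity : Prop :=
  ∀ ω₂ lam β γ : ℝ, 0 < ω₂ → 0 < lam → 0 < β → 0 < γ → ∀ T : ℝ, 0 < T → ∃ a κ C : ℝ, 0 < a ∧ 0 < κ ∧
    ∀ (N : ℕ) (i b : Fin N) (t : ℝ), (b.val = 0 ∨ b.val = N - 1) → 0 ≤ t →
    let P := pinnedChain ω₂ lam β γ
    let P₀ := pinnedChain ω₂ lam β 0
    let μT : Measure (PhaseSpace N) :=
      volume.withDensity (fun x : PhaseSpace N => ENNReal.ofReal (Real.exp (-(P.hamiltonian N x) / T)))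
    let d : ℕ := (if b.val = 0 then i.val else N - 2 - i.val)
    let g : PhaseSpace N → ℝ := fun x => ∫ y, P.bondCurrent N i y ∂(P₀.transitionKernel N T T t.toNNReal x)
    t ≤ a * (d : ℝ) →
      ∫ x, (∫ p', (g (x.1, Function.update x.2 b p') - g x) ^ 2 *
          (Real.exp (-(p' ^ 2) / (2 * T)) / Real.sqrt (2 * Real.pi * T)) ∂volume) ∂μT ≤
        C * Real.exp (-(κ * Real.sqrt ((d : ℝ) - t / a))) * ∫ x, Real.exp (-(P.hamiltonian N x) / T) ∂volume

/-- REPAIRED CRUX, finite-kick form (closest to the typed decl): kicks `s ∈ (0,1]` but NO factor `s²`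
(finite perturbations saturate inside a hot blob, so rare amplifiers contribute bounded gain), and the
stretched tail. The typed `ClosedConeSensitivity` is this with `C ↦ C s²` and `√· ↦ ·`, and that
strengthening is what the annealed amplifier refutes. -/
def FiniteKickConeSensitivity : Prop :=
  ∀ ω₂ lam β γ : ℝ, 0 < ω₂ → 0 < lam → 0 < β → 0 < γ → ∀ T : ℝ, 0 < T → ∃ a κ C : ℝ, 0 < a ∧ 0 < κ ∧
    ∀ (N : ℕ) (i b : Fin N) (t s : ℝ), (b.val = 0 ∨ b.val = N - 1) → 0 ≤ t → 0 < s → s ≤ 1 →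
    let P := pinnedChain ω₂ lam β γ
    let P₀ := pinnedChain ω₂ lam β 0
    let μT : Measure (PhaseSpace N) :=
      volume.withDensity (fun x : PhaseSpace N => ENNReal.ofReal (Real.exp (-(P.hamiltonian N x) / T)))
    let d : ℕ := (if b.val = 0 then i.val else N - 2 - i.val)
    t ≤ a * (d : ℝ) →
      ∫ x, ((∫ y, P.bondCurrent N i y ∂(P₀.transitionKernel N T T t.toNNReal (x.1, Function.update x.2 b (x.2 b + s))))
            - (∫ y, P.bondCurrent N i y ∂(P₀.transitionKernel N T T t.toNNReal x))) ^ 2 ∂μT ≤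
        C * Real.exp (-(κ * Real.sqrt ((d : ℝ) - t / a))) * ∫ x, Real.exp (-(P.hamiltonian N x) / T) ∂volume

/-- Sanity: the typed crux implies the finite-kick repair (drop `s² ≤ 1`, and `e^{-κm} ≤ e^{-κ√m}` needs
`m ≥ 1` or a constant — so only up to adjusting `C`; recorded as a `Prop`, not proved here). -/
def TypedImpliesFiniteKick : Prop :=
  Summit.AtomisticToContinuum.FouriersLaw.Theses.OddSectorIrreversibility.ClosedConeSensitivity →
    FiniteKickConeSensitivity

end Summit.AtomisticToContinuum.FouriersLaw.Cruxes.ClosedConeSensitivity.IdeatorK2
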